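import Summits.BirchSwinnertonDyer.BirchSwinnertonDyer.Theorems.KolyvaginDepthDoorDepthTableRows5
import Summits.BirchSwinnertonDyer.BirchSwinnertonDyer.Theorems.KolyvaginDepthDoorDepthTableRows6
import HarnessLib

/-!
# Route `KolyvaginDepthDoor` — DEPTH TABLE, the second and third Kolyvagin primes of each row
# (3/3: `794a1`, `817a1`, `916c1`, `944e1`, `997b1`, `997c1`), kernel-certified (crux `KolyvaginDepthSupply`, stmt-BirchSwinnertonDyer-21765)

Helper file (`--supports stmt-BirchSwinnertonDyer-21765 --as helper`); it closes nothing and BSD is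
not proved by it. The route header asks the depth table for "the three smallest Kolyvagin primes ℓ
(inert, `p ∣ ℓ+1`, `p ∣ a_ℓ`)" per curve; the row files `KolyvaginDepthDoorDepthTableRows*` fix `(p, d_K)` and certify
the least one `ℓ₁` inside the full row certificate. This file certifies, for the same `(p, d_K)`, the
next two: `Zhang2014.IsKolyvaginPrime N_E E K p ℓ ∧ (1 : ℕ∞) ≤ levelIndex E p ℓ` for every quadratic
`K` with `d_K` as listed (kernel point count `#Ẽ(𝔽_ℓ)`, inertness by the Kronecker symbol, kit lemma
`isKolyvaginPrime_of_intModel_certificate`). Feeding any of them (with its `card_ℓ`) to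
`depthRow_of_intModel_certificate` gives the corresponding row verbatim.

| curve | `p` | `d_K` (`h_K`) | `ℓ₁` | `ℓ₂` (`a`) | `ℓ₃` (`a`) |
|---|---|---|---|---|---|
| `794a1` | `5` | `-23` (`3`) | `89` | `479` (`-30`) | `709` (`-15`) |
| `817a1` | `5` | `-8` (`1`) | `239` | `269` (`-15`) | `839` (`0`) |
| `916c1` | `5` | `-111` (`8`) | `19` | `109` (`-10`) | `509` (`30`) |
| `944e1` | `5` | `-31` (`3`) | `239` | `449` (`5`) | `709` (`-25`) |
| `997b1` | `5` | `-52` (`2`) | `199` | `439` (`-10`) | `599` (`-10`) |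
| `997c1` | `5` | `-67` (`1`) | `229` | `409` (`35`) | `769` (`-5`) |

References: [WZhang2014] Notations (xii); [GrossLMS1991] §3 (3.1)–(3.3); [CremonaAlgorithms1997] Table 1.
-/


set_option linter.dupNamespace false

noncomputable section

open scoped Classical NumberField

namespace Summit.BirchSwinnertonDyer.BirchSwinnertonDyer.Theorems.KolyvaginDepthDoor

open Literature.NumberTheory.EllipticCurves Literature.NumberTheory.EllipticCurves.ModularForms
  WeierstrassCurve
open Summit.BirchSwinnertonDyer.BirchSwinnertonDyer.Rank2Observatory
open Summit.BirchSwinnertonDyer.BirchSwinnertonDyer.Rank1Residual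
open Summit.BirchSwinnertonDyer.Rank1Residual.Additive


/-! ## `794a1`: the next two Kolyvagin primes for `(p, d_K) = (5, -23)`: `ℓ = 479, 709` -/

namespace C794a1

/-- `#Ẽ(𝔽_479) = 510`, `a_479 = -30` (Kolyvagin prime: `5 ∣ 479 + 1`, `5 ∣ a_479`) for `794a1`, kernel-decided (`ℕ`-arithmetic Euler
count `PointCountNat.natCard_point_map_eq`). [cite: CremonaAlgorithms1997, Table 1 (794a1)] -/
theorem card_479 :
    Nat.card (((⟨1, 0, 1, -3, 2⟩ : WeierstrassCurve ℤ).map (Int.castRingHom (ZMod 479))).toAffine.Point) = 510 := by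
  rw [PointCountNat.natCard_point_map_eq (hℓ := ⟨by norm_num⟩) (by norm_num) 1 0 1 (-3) 2
    (by decide +kernel)]
  decide +kernel

/-- `ℓ = 479` is a Kolyvagin prime for `(794a1, p = 5, d_K = -23)` with `M(479) ≥ 1`: `479` inert
(`(-23/479) = −1`), `5 ∣ 480`, `5 ∣ a_479 = -30`; JLS cost `[K[479] : K] = 1440`. [cite: WZhang2014, Notations (xii)] -/
theorem isKolyvaginPrime_479_neg23 (K : Type) [Field K] [NumberField K]
    (h2 : Module.finrank ℚ K = 2) (hD : NumberField.discr K = -23) :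
    haveI := isGloballyMinimal_c794a1;
    Zhang2014.IsKolyvaginPrime (((⟨1, 0, 1, -3, 2⟩ : WeierstrassCurve ℤ).map (Int.castRingHom ℚ)).conductorNorm ℤ) ((⟨1, 0, 1, -3, 2⟩ : WeierstrassCurve ℤ).map (Int.castRingHom ℚ)) K 5 479 ∧
      (1 : ℕ∞) ≤ Zhang2014.levelIndex ((⟨1, 0, 1, -3, 2⟩ : WeierstrassCurve ℤ).map (Int.castRingHom ℚ)) 5 479 := by
  haveI := Fact.mk (by norm_num : Nat.Prime 5)
  haveI := isElliptic_c794a1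
  haveI := isGloballyMinimal_c794a1
  exact isKolyvaginPrime_of_intModel_certificate intModel 5 K h2 hD 479 (by norm_num) (by norm_num)
    (by decide +kernel) (by norm_num) (by norm_num) (by norm_num) (by norm_num) (n := 510) card_479
    (by norm_num)

/-- `#Ẽ(𝔽_709) = 725`, `a_709 = -15` (Kolyvagin prime: `5 ∣ 709 + 1`, `5 ∣ a_709`) for `794a1`, kernel-decided (`ℕ`-arithmetic Euler
count `PointCountNat.natCard_point_map_eq`). [cite: CremonaAlgorithms1997, Table 1 (794a1)] -/
theorem card_709 :
    Nat.card (((⟨1, 0, 1, -3, 2⟩ : WeierstrassCurve ℤ).map (Int.castRingHom (ZMod 709))).toAffine.Point) = 725 := by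
  rw [PointCountNat.natCard_point_map_eq (hℓ := ⟨by norm_num⟩) (by norm_num) 1 0 1 (-3) 2
    (by decide +kernel)]
  decide +kernel

/-- `ℓ = 709` is a Kolyvagin prime for `(794a1, p = 5, d_K = -23)` with `M(709) ≥ 1`: `709` inert
(`(-23/709) = −1`), `5 ∣ 710`, `5 ∣ a_709 = -15`; JLS cost `[K[709] : K] = 2130`. [cite: WZhang2014, Notations (xii)] -/
theorem isKolyvaginPrime_709_neg23 (K : Type) [Field K] [NumberField K]
    (h2 : Module.finrank ℚ K = 2) (hD : NumberField.discr K = -23) :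
    haveI := isGloballyMinimal_c794a1;
    Zhang2014.IsKolyvaginPrime (((⟨1, 0, 1, -3, 2⟩ : WeierstrassCurve ℤ).map (Int.castRingHom ℚ)).conductorNorm ℤ) ((⟨1, 0, 1, -3, 2⟩ : WeierstrassCurve ℤ).map (Int.castRingHom ℚ)) K 5 709 ∧
      (1 : ℕ∞) ≤ Zhang2014.levelIndex ((⟨1, 0, 1, -3, 2⟩ : WeierstrassCurve ℤ).map (Int.castRingHom ℚ)) 5 709 := by
  haveI := Fact.mk (by norm_num : Nat.Prime 5)
  haveI := isElliptic_c794a1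
  haveI := isGloballyMinimal_c794a1
  exact isKolyvaginPrime_of_intModel_certificate intModel 5 K h2 hD 709 (by norm_num) (by norm_num)
    (by decide +kernel) (by norm_num) (by norm_num) (by norm_num) (by norm_num) (n := 725) card_709
    (by norm_num)

end C794a1

/-! ## `817a1`: the next two Kolyvagin primes for `(p, d_K) = (5, -8)`: `ℓ = 269, 839` -/

namespace C817a1

/-- `#Ẽ(𝔽_269) = 285`, `a_269 = -15` (Kolyvagin prime: `5 ∣ 269 + 1`, `5 ∣ a_269`) for `817a1`, kernel-decided (`ℕ`-arithmetic Euler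
count `PointCountNat.natCard_point_map_eq`). [cite: CremonaAlgorithms1997, Table 1 (817a1)] -/
theorem card_269 :
    Nat.card (((⟨0, 1, 1, 1, 6⟩ : WeierstrassCurve ℤ).map (Int.castRingHom (ZMod 269))).toAffine.Point) = 285 := by
  rw [PointCountNat.natCard_point_map_eq (hℓ := ⟨by norm_num⟩) (by norm_num) 0 1 1 1 6
    (by decide +kernel)]
  decide +kernel

/-- `ℓ = 269` is a Kolyvagin prime for `(817a1, p = 5, d_K = -8)` with `M(269) ≥ 1`: `269` inert
(`(-8/269) = −1`), `5 ∣ 270`, `5 ∣ a_269 = -15`; JLS cost `[K[269] : K] = 270`. [cite: WZhang2014, Notations (xii)] -/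
theorem isKolyvaginPrime_269_neg8 (K : Type) [Field K] [NumberField K]
    (h2 : Module.finrank ℚ K = 2) (hD : NumberField.discr K = -8) :
    haveI := isGloballyMinimal_c817a1;
    Zhang2014.IsKolyvaginPrime (((⟨0, 1, 1, 1, 6⟩ : WeierstrassCurve ℤ).map (Int.castRingHom ℚ)).conductorNorm ℤ) ((⟨0, 1, 1, 1, 6⟩ : WeierstrassCurve ℤ).map (Int.castRingHom ℚ)) K 5 269 ∧
      (1 : ℕ∞) ≤ Zhang2014.levelIndex ((⟨0, 1, 1, 1, 6⟩ : WeierstrassCurve ℤ).map (Int.castRingHom ℚ)) 5 269 := by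
  haveI := Fact.mk (by norm_num : Nat.Prime 5)
  haveI := isElliptic_c817a1
  haveI := isGloballyMinimal_c817a1
  exact isKolyvaginPrime_of_intModel_certificate intModel 5 K h2 hD 269 (by norm_num) (by norm_num)
    (by decide +kernel) (by norm_num) (by norm_num) (by norm_num) (by norm_num) (n := 285) card_269
    (by norm_num)

/-- `#Ẽ(𝔽_839) = 840`, `a_839 = 0` (Kolyvagin prime: `5 ∣ 839 + 1`, `5 ∣ a_839`) for `817a1`, kernel-decided (`ℕ`-arithmetic Euler
count `PointCountNat.natCard_point_map_eq`). [cite: CremonaAlgorithms1997, Table 1 (817a1)] -/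
theorem card_839 :
    Nat.card (((⟨0, 1, 1, 1, 6⟩ : WeierstrassCurve ℤ).map (Int.castRingHom (ZMod 839))).toAffine.Point) = 840 := by
  rw [PointCountNat.natCard_point_map_eq (hℓ := ⟨by norm_num⟩) (by norm_num) 0 1 1 1 6
    (by decide +kernel)]
  decide +kernel

/-- `ℓ = 839` is a Kolyvagin prime for `(817a1, p = 5, d_K = -8)` with `M(839) ≥ 1`: `839` inert
(`(-8/839) = −1`), `5 ∣ 840`, `5 ∣ a_839 = 0`; JLS cost `[K[839] : K] = 840`. [cite: WZhang2014, Notations (xii)] -/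
theorem isKolyvaginPrime_839_neg8 (K : Type) [Field K] [NumberField K]
    (h2 : Module.finrank ℚ K = 2) (hD : NumberField.discr K = -8) :
    haveI := isGloballyMinimal_c817a1;
    Zhang2014.IsKolyvaginPrime (((⟨0, 1, 1, 1, 6⟩ : WeierstrassCurve ℤ).map (Int.castRingHom ℚ)).conductorNorm ℤ) ((⟨0, 1, 1, 1, 6⟩ : WeierstrassCurve ℤ).map (Int.castRingHom ℚ)) K 5 839 ∧
      (1 : ℕ∞) ≤ Zhang2014.levelIndex ((⟨0, 1, 1, 1, 6⟩ : WeierstrassCurve ℤ).map (Int.castRingHom ℚ)) 5 839 := by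
  haveI := Fact.mk (by norm_num : Nat.Prime 5)
  haveI := isElliptic_c817a1
  haveI := isGloballyMinimal_c817a1
  exact isKolyvaginPrime_of_intModel_certificate intModel 5 K h2 hD 839 (by norm_num) (by norm_num)
    (by decide +kernel) (by norm_num) (by norm_num) (by norm_num) (by norm_num) (n := 840) card_839
    (by norm_num)

end C817a1

/-! ## `916c1`: the next two Kolyvagin primes for `(p, d_K) = (5, -111)`: `ℓ = 109, 509` -/

namespace C916c1

/-- `#Ẽ(𝔽_109) = 120`, `a_109 = -10` (Kolyvagin prime: `5 ∣ 109 + 1`, `5 ∣ a_109`) for `916c1`, kernel-decided (`ℕ`-arithmetic Euler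
count `PointCountNat.natCard_point_map_eq`). [cite: CremonaAlgorithms1997, Table 1 (916c1)] -/
theorem card_109 :
    Nat.card (((⟨0, 0, 0, -4, 1⟩ : WeierstrassCurve ℤ).map (Int.castRingHom (ZMod 109))).toAffine.Point) = 120 := by
  rw [PointCountNat.natCard_point_map_eq (hℓ := ⟨by norm_num⟩) (by norm_num) 0 0 0 (-4) 1
    (by decide +kernel)]
  decide +kernel

/-- `ℓ = 109` is a Kolyvagin prime for `(916c1, p = 5, d_K = -111)` with `M(109) ≥ 1`: `109` inert
(`(-111/109) = −1`), `5 ∣ 110`, `5 ∣ a_109 = -10`; JLS cost `[K[109] : K] = 880`. [cite: WZhang2014, Notations (xii)] -/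
theorem isKolyvaginPrime_109_neg111 (K : Type) [Field K] [NumberField K]
    (h2 : Module.finrank ℚ K = 2) (hD : NumberField.discr K = -111) :
    haveI := isGloballyMinimal_c916c1;
    Zhang2014.IsKolyvaginPrime (((⟨0, 0, 0, -4, 1⟩ : WeierstrassCurve ℤ).map (Int.castRingHom ℚ)).conductorNorm ℤ) ((⟨0, 0, 0, -4, 1⟩ : WeierstrassCurve ℤ).map (Int.castRingHom ℚ)) K 5 109 ∧
      (1 : ℕ∞) ≤ Zhang2014.levelIndex ((⟨0, 0, 0, -4, 1⟩ : WeierstrassCurve ℤ).map (Int.castRingHom ℚ)) 5 109 := by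
  haveI := Fact.mk (by norm_num : Nat.Prime 5)
  haveI := isElliptic_c916c1
  haveI := isGloballyMinimal_c916c1
  exact isKolyvaginPrime_of_intModel_certificate intModel 5 K h2 hD 109 (by norm_num) (by norm_num)
    (by decide +kernel) (by norm_num) (by norm_num) (by norm_num) (by norm_num) (n := 120) card_109
    (by norm_num)

/-- `#Ẽ(𝔽_509) = 480`, `a_509 = 30` (Kolyvagin prime: `5 ∣ 509 + 1`, `5 ∣ a_509`) for `916c1`, kernel-decided (`ℕ`-arithmetic Euler
count `PointCountNat.natCard_point_map_eq`). [cite: CremonaAlgorithms1997, Table 1 (916c1)] -/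
theorem card_509 :
    Nat.card (((⟨0, 0, 0, -4, 1⟩ : WeierstrassCurve ℤ).map (Int.castRingHom (ZMod 509))).toAffine.Point) = 480 := by
  rw [PointCountNat.natCard_point_map_eq (hℓ := ⟨by norm_num⟩) (by norm_num) 0 0 0 (-4) 1
    (by decide +kernel)]
  decide +kernel

/-- `ℓ = 509` is a Kolyvagin prime for `(916c1, p = 5, d_K = -111)` with `M(509) ≥ 1`: `509` inert
(`(-111/509) = −1`), `5 ∣ 510`, `5 ∣ a_509 = 30`; JLS cost `[K[509] : K] = 4080`. [cite: WZhang2014, Notations (xii)] -/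
theorem isKolyvaginPrime_509_neg111 (K : Type) [Field K] [NumberField K]
    (h2 : Module.finrank ℚ K = 2) (hD : NumberField.discr K = -111) :
    haveI := isGloballyMinimal_c916c1;
    Zhang2014.IsKolyvaginPrime (((⟨0, 0, 0, -4, 1⟩ : WeierstrassCurve ℤ).map (Int.castRingHom ℚ)).conductorNorm ℤ) ((⟨0, 0, 0, -4, 1⟩ : WeierstrassCurve ℤ).map (Int.castRingHom ℚ)) K 5 509 ∧
      (1 : ℕ∞) ≤ Zhang2014.levelIndex ((⟨0, 0, 0, -4, 1⟩ : WeierstrassCurve ℤ).map (Int.castRingHom ℚ)) 5 509 := by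
  haveI := Fact.mk (by norm_num : Nat.Prime 5)
  haveI := isElliptic_c916c1
  haveI := isGloballyMinimal_c916c1
  exact isKolyvaginPrime_of_intModel_certificate intModel 5 K h2 hD 509 (by norm_num) (by norm_num)
    (by decide +kernel) (by norm_num) (by norm_num) (by norm_num) (by norm_num) (n := 480) card_509
    (by norm_num)

end C916c1

/-! ## `944e1`: the next two Kolyvagin primes for `(p, d_K) = (5, -31)`: `ℓ = 449, 709` -/

namespace C944e1

/-- `#Ẽ(𝔽_449) = 445`, `a_449 = 5` (Kolyvagin prime: `5 ∣ 449 + 1`, `5 ∣ a_449`) for `944e1`, kernel-decided (`ℕ`-arithmetic Euler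
count `PointCountNat.natCard_point_map_eq`). [cite: CremonaAlgorithms1997, Table 1 (944e1)] -/
theorem card_449 :
    Nat.card (((⟨0, 0, 0, -19, 34⟩ : WeierstrassCurve ℤ).map (Int.castRingHom (ZMod 449))).toAffine.Point) = 445 := by
  rw [PointCountNat.natCard_point_map_eq (hℓ := ⟨by norm_num⟩) (by norm_num) 0 0 0 (-19) 34
    (by decide +kernel)]
  decide +kernel

/-- `ℓ = 449` is a Kolyvagin prime for `(944e1, p = 5, d_K = -31)` with `M(449) ≥ 1`: `449` inert
(`(-31/449) = −1`), `5 ∣ 450`, `5 ∣ a_449 = 5`; JLS cost `[K[449] : K] = 1350`. [cite: WZhang2014, Notations (xii)] -/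
theorem isKolyvaginPrime_449_neg31 (K : Type) [Field K] [NumberField K]
    (h2 : Module.finrank ℚ K = 2) (hD : NumberField.discr K = -31) :
    haveI := isGloballyMinimal_c944e1;
    Zhang2014.IsKolyvaginPrime (((⟨0, 0, 0, -19, 34⟩ : WeierstrassCurve ℤ).map (Int.castRingHom ℚ)).conductorNorm ℤ) ((⟨0, 0, 0, -19, 34⟩ : WeierstrassCurve ℤ).map (Int.castRingHom ℚ)) K 5 449 ∧
      (1 : ℕ∞) ≤ Zhang2014.levelIndex ((⟨0, 0, 0, -19, 34⟩ : WeierstrassCurve ℤ).map (Int.castRingHom ℚ)) 5 449 := by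
  haveI := Fact.mk (by norm_num : Nat.Prime 5)
  haveI := isElliptic_c944e1
  haveI := isGloballyMinimal_c944e1
  exact isKolyvaginPrime_of_intModel_certificate intModel 5 K h2 hD 449 (by norm_num) (by norm_num)
    (by decide +kernel) (by norm_num) (by norm_num) (by norm_num) (by norm_num) (n := 445) card_449
    (by norm_num)

/-- `#Ẽ(𝔽_709) = 735`, `a_709 = -25` (Kolyvagin prime: `5 ∣ 709 + 1`, `5 ∣ a_709`) for `944e1`, kernel-decided (`ℕ`-arithmetic Euler
count `PointCountNat.natCard_point_map_eq`). [cite: CremonaAlgorithms1997, Table 1 (944e1)] -/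
theorem card_709 :
    Nat.card (((⟨0, 0, 0, -19, 34⟩ : WeierstrassCurve ℤ).map (Int.castRingHom (ZMod 709))).toAffine.Point) = 735 := by
  rw [PointCountNat.natCard_point_map_eq (hℓ := ⟨by norm_num⟩) (by norm_num) 0 0 0 (-19) 34
    (by decide +kernel)]
  decide +kernel

/-- `ℓ = 709` is a Kolyvagin prime for `(944e1, p = 5, d_K = -31)` with `M(709) ≥ 1`: `709` inert
(`(-31/709) = −1`), `5 ∣ 710`, `5 ∣ a_709 = -25`; JLS cost `[K[709] : K] = 2130`. [cite: WZhang2014, Notations (xii)] -/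
theorem isKolyvaginPrime_709_neg31 (K : Type) [Field K] [NumberField K]
    (h2 : Module.finrank ℚ K = 2) (hD : NumberField.discr K = -31) :
    haveI := isGloballyMinimal_c944e1;
    Zhang2014.IsKolyvaginPrime (((⟨0, 0, 0, -19, 34⟩ : WeierstrassCurve ℤ).map (Int.castRingHom ℚ)).conductorNorm ℤ) ((⟨0, 0, 0, -19, 34⟩ : WeierstrassCurve ℤ).map (Int.castRingHom ℚ)) K 5 709 ∧
      (1 : ℕ∞) ≤ Zhang2014.levelIndex ((⟨0, 0, 0, -19, 34⟩ : WeierstrassCurve ℤ).map (Int.castRingHom ℚ)) 5 709 := by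
  haveI := Fact.mk (by norm_num : Nat.Prime 5)
  haveI := isElliptic_c944e1
  haveI := isGloballyMinimal_c944e1
  exact isKolyvaginPrime_of_intModel_certificate intModel 5 K h2 hD 709 (by norm_num) (by norm_num)
    (by decide +kernel) (by norm_num) (by norm_num) (by norm_num) (by norm_num) (n := 735) card_709
    (by norm_num)

end C944e1

/-! ## `997b1`: the next two Kolyvagin primes for `(p, d_K) = (5, -52)`: `ℓ = 439, 599` -/

namespace C997b1

/-- `#Ẽ(𝔽_439) = 450`, `a_439 = -10` (Kolyvagin prime: `5 ∣ 439 + 1`, `5 ∣ a_439`) for `997b1`, kernel-decided (`ℕ`-arithmetic Euler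
count `PointCountNat.natCard_point_map_eq`). [cite: CremonaAlgorithms1997, Table 1 (997b1)] -/
theorem card_439 :
    Nat.card (((⟨0, -1, 1, -5, -3⟩ : WeierstrassCurve ℤ).map (Int.castRingHom (ZMod 439))).toAffine.Point) = 450 := by
  rw [PointCountNat.natCard_point_map_eq (hℓ := ⟨by norm_num⟩) (by norm_num) 0 (-1) 1 (-5) (-3)
    (by decide +kernel)]
  decide +kernel

/-- `ℓ = 439` is a Kolyvagin prime for `(997b1, p = 5, d_K = -52)` with `M(439) ≥ 1`: `439` inert
(`(-52/439) = −1`), `5 ∣ 440`, `5 ∣ a_439 = -10`; JLS cost `[K[439] : K] = 880`. [cite: WZhang2014, Notations (xii)] -/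
theorem isKolyvaginPrime_439_neg52 (K : Type) [Field K] [NumberField K]
    (h2 : Module.finrank ℚ K = 2) (hD : NumberField.discr K = -52) :
    haveI := isGloballyMinimal_c997b1;
    Zhang2014.IsKolyvaginPrime (((⟨0, -1, 1, -5, -3⟩ : WeierstrassCurve ℤ).map (Int.castRingHom ℚ)).conductorNorm ℤ) ((⟨0, -1, 1, -5, -3⟩ : WeierstrassCurve ℤ).map (Int.castRingHom ℚ)) K 5 439 ∧
      (1 : ℕ∞) ≤ Zhang2014.levelIndex ((⟨0, -1, 1, -5, -3⟩ : WeierstrassCurve ℤ).map (Int.castRingHom ℚ)) 5 439 := by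
  haveI := Fact.mk (by norm_num : Nat.Prime 5)
  haveI := isElliptic_c997b1
  haveI := isGloballyMinimal_c997b1
  exact isKolyvaginPrime_of_intModel_certificate intModel 5 K h2 hD 439 (by norm_num) (by norm_num)
    (by decide +kernel) (by norm_num) (by norm_num) (by norm_num) (by norm_num) (n := 450) card_439
    (by norm_num)

/-- `#Ẽ(𝔽_599) = 610`, `a_599 = -10` (Kolyvagin prime: `5 ∣ 599 + 1`, `5 ∣ a_599`) for `997b1`, kernel-decided (`ℕ`-arithmetic Euler
count `PointCountNat.natCard_point_map_eq`). [cite: CremonaAlgorithms1997, Table 1 (997b1)] -/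
theorem card_599 :
    Nat.card (((⟨0, -1, 1, -5, -3⟩ : WeierstrassCurve ℤ).map (Int.castRingHom (ZMod 599))).toAffine.Point) = 610 := by
  rw [PointCountNat.natCard_point_map_eq (hℓ := ⟨by norm_num⟩) (by norm_num) 0 (-1) 1 (-5) (-3)
    (by decide +kernel)]
  decide +kernel

/-- `ℓ = 599` is a Kolyvagin prime for `(997b1, p = 5, d_K = -52)` with `M(599) ≥ 1`: `599` inert
(`(-52/599) = −1`), `5 ∣ 600`, `5 ∣ a_599 = -10`; JLS cost `[K[599] : K] = 1200`. [cite: WZhang2014, Notations (xii)] -/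
theorem isKolyvaginPrime_599_neg52 (K : Type) [Field K] [NumberField K]
    (h2 : Module.finrank ℚ K = 2) (hD : NumberField.discr K = -52) :
    haveI := isGloballyMinimal_c997b1;
    Zhang2014.IsKolyvaginPrime (((⟨0, -1, 1, -5, -3⟩ : WeierstrassCurve ℤ).map (Int.castRingHom ℚ)).conductorNorm ℤ) ((⟨0, -1, 1, -5, -3⟩ : WeierstrassCurve ℤ).map (Int.castRingHom ℚ)) K 5 599 ∧
      (1 : ℕ∞) ≤ Zhang2014.levelIndex ((⟨0, -1, 1, -5, -3⟩ : WeierstrassCurve ℤ).map (Int.castRingHom ℚ)) 5 599 := by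
  haveI := Fact.mk (by norm_num : Nat.Prime 5)
  haveI := isElliptic_c997b1
  haveI := isGloballyMinimal_c997b1
  exact isKolyvaginPrime_of_intModel_certificate intModel 5 K h2 hD 599 (by norm_num) (by norm_num)
    (by decide +kernel) (by norm_num) (by norm_num) (by norm_num) (by norm_num) (n := 610) card_599
    (by norm_num)

end C997b1

/-! ## `997c1`: the next two Kolyvagin primes for `(p, d_K) = (5, -67)`: `ℓ = 409, 769` -/

namespace C997c1

/-- `#Ẽ(𝔽_409) = 375`, `a_409 = 35` (Kolyvagin prime: `5 ∣ 409 + 1`, `5 ∣ a_409`) for `997c1`, kernel-decided (`ℕ`-arithmetic Euler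
count `PointCountNat.natCard_point_map_eq`). [cite: CremonaAlgorithms1997, Table 1 (997c1)] -/
theorem card_409 :
    Nat.card (((⟨0, -1, 1, -24, 54⟩ : WeierstrassCurve ℤ).map (Int.castRingHom (ZMod 409))).toAffine.Point) = 375 := by
  rw [PointCountNat.natCard_point_map_eq (hℓ := ⟨by norm_num⟩) (by norm_num) 0 (-1) 1 (-24) 54
    (by decide +kernel)]
  decide +kernel

/-- `ℓ = 409` is a Kolyvagin prime for `(997c1, p = 5, d_K = -67)` with `M(409) ≥ 1`: `409` inert
(`(-67/409) = −1`), `5 ∣ 410`, `5 ∣ a_409 = 35`; JLS cost `[K[409] : K] = 410`. [cite: WZhang2014, Notations (xii)] -/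
theorem isKolyvaginPrime_409_neg67 (K : Type) [Field K] [NumberField K]
    (h2 : Module.finrank ℚ K = 2) (hD : NumberField.discr K = -67) :
    haveI := isGloballyMinimal_c997c1;
    Zhang2014.IsKolyvaginPrime (((⟨0, -1, 1, -24, 54⟩ : WeierstrassCurve ℤ).map (Int.castRingHom ℚ)).conductorNorm ℤ) ((⟨0, -1, 1, -24, 54⟩ : WeierstrassCurve ℤ).map (Int.castRingHom ℚ)) K 5 409 ∧
      (1 : ℕ∞) ≤ Zhang2014.levelIndex ((⟨0, -1, 1, -24, 54⟩ : WeierstrassCurve ℤ).map (Int.castRingHom ℚ)) 5 409 := by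
  haveI := Fact.mk (by norm_num : Nat.Prime 5)
  haveI := isElliptic_c997c1
  haveI := isGloballyMinimal_c997c1
  exact isKolyvaginPrime_of_intModel_certificate intModel 5 K h2 hD 409 (by norm_num) (by norm_num)
    (by decide +kernel) (by norm_num) (by norm_num) (by norm_num) (by norm_num) (n := 375) card_409
    (by norm_num)

/-- `#Ẽ(𝔽_769) = 775`, `a_769 = -5` (Kolyvagin prime: `5 ∣ 769 + 1`, `5 ∣ a_769`) for `997c1`, kernel-decided (`ℕ`-arithmetic Euler
count `PointCountNat.natCard_point_map_eq`). [cite: CremonaAlgorithms1997, Table 1 (997c1)] -/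
theorem card_769 :
    Nat.card (((⟨0, -1, 1, -24, 54⟩ : WeierstrassCurve ℤ).map (Int.castRingHom (ZMod 769))).toAffine.Point) = 775 := by
  rw [PointCountNat.natCard_point_map_eq (hℓ := ⟨by norm_num⟩) (by norm_num) 0 (-1) 1 (-24) 54
    (by decide +kernel)]
  decide +kernel

/-- `ℓ = 769` is a Kolyvagin prime for `(997c1, p = 5, d_K = -67)` with `M(769) ≥ 1`: `769` inert
(`(-67/769) = −1`), `5 ∣ 770`, `5 ∣ a_769 = -5`; JLS cost `[K[769] : K] = 770`. [cite: WZhang2014, Notations (xii)] -/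
theorem isKolyvaginPrime_769_neg67 (K : Type) [Field K] [NumberField K]
    (h2 : Module.finrank ℚ K = 2) (hD : NumberField.discr K = -67) :
    haveI := isGloballyMinimal_c997c1;
    Zhang2014.IsKolyvaginPrime (((⟨0, -1, 1, -24, 54⟩ : WeierstrassCurve ℤ).map (Int.castRingHom ℚ)).conductorNorm ℤ) ((⟨0, -1, 1, -24, 54⟩ : WeierstrassCurve ℤ).map (Int.castRingHom ℚ)) K 5 769 ∧
      (1 : ℕ∞) ≤ Zhang2014.levelIndex ((⟨0, -1, 1, -24, 54⟩ : WeierstrassCurve ℤ).map (Int.castRingHom ℚ)) 5 769 := by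
  haveI := Fact.mk (by norm_num : Nat.Prime 5)
  haveI := isElliptic_c997c1
  haveI := isGloballyMinimal_c997c1
  exact isKolyvaginPrime_of_intModel_certificate intModel 5 K h2 hD 769 (by norm_num) (by norm_num)
    (by decide +kernel) (by norm_num) (by norm_num) (by norm_num) (by norm_num) (n := 775) card_769
    (by norm_num)

end C997c1

end Summit.BirchSwinnertonDyer.BirchSwinnertonDyer.Theorems.KolyvaginDepthDoor

end
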